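import Summits.CriticalPhenomena.PercolationContinuityZ3.Theorems.PercNearOneGluingNoHeavyLowerTailSahiCombTriWRelSatCert

/-!
# The RELATIVELY SATURATED stratum of `TRI_W(a)`: up-sets saturated inside a face `↑m`, by a cross-point sandwich certificate

Support file of the one-cut programme (crux `NoHeavyLowerTail`, stmt-CriticalPhenomena-4575; TRI lane of cell `prim-masterthm`; seat prim-lf-1 gen 39,
memo `FROM-prim-lf-1-gen39-SATURATED-STRATUM.md` §5).  Part 2 of 2 (part 1 = `…SahiCombTriWRelSatCert`: the certificate `kapRel`, its value `ptVal_kapRel` and the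
upper bound `ptVal_kapRel_le_uForm`).  Continuation of `…SahiCombTriWSaturated` (the saturated stratum, `triW_nonneg_of_saturated`) and
`…SahiCombTriWSandwich` (P5 gen 24: `SandwichPt`, `triW_nonneg_of_sandwichPt`).

Fix `m : Finset γ`, the face `Φ = ↑m = {t | m ⊆ t}` and the FACE COMPLEMENT `ρ t = m ∪ tᶜ` (an order-reversing involution of `Φ`).  An up-set `P ⊆ Φ` is
RELATIVELY SATURATED if `t ∈ P ∨ ρ t ∈ P` for every `t ⊇ m`.  Examples: `m = ∅` = the saturated up-sets of `…TriWSaturated`; `P = Φ` = the principal up-set `↑m`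
(every `m`); `↑{0,1} ∪ ↑{0,2} = ↑{0} \ {{0}}` (`m = {0}`); at `n = 4` 140 of the 167 non-empty up-sets are relatively saturated in some face (and the certificate below
is valid for every such pair `(P, m)`, lab/relsat.py of the memo).  The CROSS-POINT weight

  `κ_rel(t, ρ t) = 1` for `t ∈ P ∩ ρP`,   `κ_rel(t, t) = 1` for `t ∈ P \ ρP`      (`FiveUpSet.kapRel`; point pairs `(t, m ∪ tᶜ)`, P5's "tier 2" atoms)

is a sandwich certificate (`FiveUpSet.sandwichPt_kapRel`), hence (**`FiveUpSet.triW_nonneg_of_relSaturated`**) `0 ≤ triW P F G` for every relatively saturated `P`, EVERY index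
cube and all monotone families — `TriWIneq` on the relatively saturated stratum (all `n`, all `a`); corollary `triW_nonneg_principal'` (every principal up-set, new proof).
PROOF.  Upper bound (`ptVal_kapRel_le_uForm`): the five-up-set theorem for the test up-set `A ∩ Φ` and the nested pairs (m-cylinder of `P \ ρP` ⊆ m-cylinder of `P`),
(`∅` ⊆ m-cylinder of `B`), plus `tᶜ ⊆ ρ t` and the involution `ρ` on `P ∩ ρP`.  Lower bound (`lForm_le_ptVal_kapRel`): the EXACT IDENTITY
`κ_rel(A×B) − L_P(A,B) = [#(X ∩ Y) − #(X ∩ refl Y)] + #{t ∈ P∩ρP∩A | t\m ∉ A, ρt ∈ B, tᶜ ∉ B}` with the up-sets `X = {t ⊇ m | t\m ∈ A ∨ (t ∈ P\ρP ∧ t ∈ A)}`,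
`Y = {f | f\m ∈ B ∨ (f∪m ∈ P\ρP ∧ f∪m ∈ B)}` (Kleitman's lemma bounds the bracket below by 0); the identity is proved point-pair-wise along the involution `ρ`
(`relPair_eq_zero`, a `decide` over the ten membership bits).  In the face cube `2^{mᶜ}` this is the nested-pair form of the saturated lower bound:
`κ_A(P̃)(A₁,B₁) − [#(P̃∩rA₀∩B₁)+#(P̃∩A₁∩rB₀)−#(rP̃∩A₀∩B₀)] = Kl(A₀∪(P̃₁∩A₁), B₀∪(P̃₁∩B₁)) + #(Q̃∩(A₁\A₀)∩r(B₁\B₀))` for traces `A₀ ⊆ A₁`, `B₀ ⊆ B₁`.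
HONEST LABEL: complete proofs, std axioms; a new unconditional stratum of `TriWIneq` (all `n`, all `a`) containing the saturated and the principal strata;
`TriWIneq` itself stays OPEN (at `n = 4` the 27 up-sets outside this stratum are the `K₂₂` orbit and the 'saturated minus a 2-element generator' family). [this work]
-/

namespace Summit.CriticalPhenomena.PercolationContinuityZ3.Theorems

namespace FiveUpSet

open Finset

variable {β γ : Type} [DecidableEq β] [Fintype β] [DecidableEq γ] [Fintype γ]

/-! ### The point-pair identity behind the lower bound -/

/-- Integer value of a Boolean. -/
private def bz (x : Bool) : ℤ := if x then 1 else 0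

/-- The per-point integrand of `κ_rel − L_P − [Kleitman bracket + extra]` in the ten membership bits
`p=[t∈P], q=[ρt∈P], a=[t∈A], a0=[t\m∈A], a1=[ρt∈A], ac=[tᶜ∈A]` (and `b,b0,b1,bc`). [this work] -/
private def relD (p q a a0 a1 ac b b0 b1 bc : Bool) : ℤ :=
  -- F = [t∈P]·([ρt∈P] a b1 + [ρt∉P] a b − ac·b − a·bc + ac·bc)   (κ_rel − L_P integrand)
  bz p * (bz q * bz a * bz b1 + (1 - bz q) * bz a * bz b - bz ac * bz b - bz a * bz bc + bz ac * bz bc)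
  -- minus G = x·(y − y') + p q a (1−a0) b1 (1−bc),  x = [a0 ∨ (p ∧ ¬q ∧ a)], y = [b0 ∨ (p ∧ ¬q ∧ b)], y' = [bc ∨ (q ∧ ¬p ∧ b1)]
  - (bz (a0 || (p && !q && a)) * (bz (b0 || (p && !q && b)) - bz (bc || (q && !p && b1)))
      + bz p * bz q * bz a * (1 - bz a0) * bz b1 * (1 - bz bc)) + 0 * bz a1

/-- **Point-pair identity**: along the involution `ρ` (which permutes the bits as `(p,q,a,a0,a1,ac,b,b0,b1,bc) ↦ (q,p,a1,ac,a,a0,b1,bc,b,b0)`) the integrand `relD`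
is antisymmetric on every consistent membership pattern (`a0 → a`, `ac → a1`, `b0 → b`, `bc → b1`, `p ∨ q`). [this work] -/
private theorem relPair_eq_zero :
    ∀ p q a a0 a1 ac b b0 b1 bc : Bool, (p || q) = true → (a0 → a) → (ac → a1) → (b0 → b) → (bc → b1) →
      relD p q a a0 a1 ac b b0 b1 bc + relD q p a1 ac a a0 b1 bc b b0 = 0 := by
  decide

/-! ### The lower bound and the stratum theorem -/

omit [DecidableEq β] [Fintype β] in
/-- **Lower bound `L_P(A,B) ≤ κ_rel(A×B)`** for relatively saturated `P ⊆ ↑m` and all up-sets `A, B`. [this work] -/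
theorem lForm_le_ptVal_kapRel {m : Finset γ} {P A B : Finset (Finset γ)} (hP : IsUpperSet (P : Set (Finset γ)))
    (hPm : ∀ t ∈ P, m ⊆ t) (hsat : ∀ t : Finset γ, m ⊆ t → t ∈ P ∨ m ∪ tᶜ ∈ P)
    (hA : IsUpperSet (A : Set (Finset γ))) (hB : IsUpperSet (B : Set (Finset γ))) :
    lForm P A B ≤ ptVal (kapRel m P) A B := by
  classical
  set Φ : Finset (Finset γ) := univ.filter (fun t => m ⊆ t) with hΦ
  -- the two up-sets of the Kleitman bracket
  set X : Finset (Finset γ) := Φ.filter (fun t => t \ m ∈ A ∨ (t ∈ P ∧ m ∪ tᶜ ∉ P ∧ t ∈ A)) with hX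
  set Y : Finset (Finset γ) := univ.filter (fun f => f \ m ∈ B ∨ (f ∪ m ∈ P ∧ m ∪ (f ∪ m)ᶜ ∉ P ∧ f ∪ m ∈ B)) with hY
  have hm_of_face : ∀ {t : Finset γ}, t ∈ Φ → m ⊆ t := fun ht => by rw [hΦ, mem_filter] at ht; exact ht.2
  have hXu : IsUpperSet (X : Set (Finset γ)) := by
    intro f g hfg hf
    rw [mem_coe, hX, mem_filter] at hf ⊢
    have hmf := hm_of_face hf.1
    have hmg : m ⊆ g := hmf.trans hfg
    refine ⟨by rw [hΦ, mem_filter]; exact ⟨mem_univ _, hmg⟩, ?_⟩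
    rcases hf.2 with h | ⟨hfP, hρ, hfA⟩
    · exact Or.inl (hA (sdiff_subset_sdiff hfg (Subset.refl m)) h)
    · right
      refine ⟨hP hfg hfP, fun hg => hρ (hP (show m ∪ gᶜ ≤ m ∪ fᶜ from union_subset_union (Subset.refl m) (compl_subset_compl.2 hfg)) hg), hA hfg hfA⟩
  have hYu : IsUpperSet (Y : Set (Finset γ)) := by
    intro f g hfg hf
    rw [mem_coe, hY, mem_filter] at hf ⊢
    refine ⟨mem_univ _, ?_⟩
    have hfg' : f ∪ m ⊆ g ∪ m := union_subset_union hfg (Subset.refl m)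
    rcases hf.2 with h | ⟨hfP, hρ, hfB⟩
    · exact Or.inl (hB (sdiff_subset_sdiff hfg (Subset.refl m)) h)
    · right
      refine ⟨hP hfg' hfP, fun hg => hρ (hP (show m ∪ (g ∪ m)ᶜ ≤ m ∪ (f ∪ m)ᶜ from
        union_subset_union (Subset.refl m) (compl_subset_compl.2 hfg')) hg), hB hfg' hfB⟩
  -- Kleitman for `X, Y`
  have hk := card_inter_refl_le hXu hYu   -- #(X ∩ refl Y) ≤ #(X ∩ Y)
  -- both as sums over Φ
  have hXΦ : X ⊆ Φ := Finset.filter_subset _ _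
  have eXY : ((X ∩ Y).card : ℤ) = ∑ t ∈ Φ, ibit (t ∈ X) * ibit (t ∈ Y) := by
    rw [show X ∩ Y = Φ ∩ X ∩ Y by rw [inter_eq_right.2 hXΦ]]
    exact card_inter_inter_eq_sum_ibit Φ X Y
  have eXrY : ((X ∩ refl Y).card : ℤ) = ∑ t ∈ Φ, ibit (t ∈ X) * ibit (tᶜ ∈ Y) := by
    rw [show X ∩ refl Y = Φ ∩ X ∩ refl Y by rw [inter_eq_right.2 hXΦ], card_inter_inter_eq_sum_ibit]
    refine Finset.sum_congr rfl fun t _ => ?_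
    unfold ibit; simp only [mem_refl]
  -- membership characterisations at a face point
  have memX : ∀ {t}, m ⊆ t → (t ∈ X ↔ (t \ m ∈ A ∨ (t ∈ P ∧ m ∪ tᶜ ∉ P ∧ t ∈ A))) := by
    intro t hmt; rw [hX, mem_filter, hΦ, mem_filter]; simp [hmt]
  have memY : ∀ {t}, m ⊆ t → (t ∈ Y ↔ (t \ m ∈ B ∨ (t ∈ P ∧ m ∪ tᶜ ∉ P ∧ t ∈ B))) := by
    intro t hmt; rw [hY, mem_filter, union_eq_left.2 hmt]; simp
  have memYc : ∀ {t}, m ⊆ t → (tᶜ ∈ Y ↔ (tᶜ ∈ B ∨ (m ∪ tᶜ ∈ P ∧ t ∉ P ∧ m ∪ tᶜ ∈ B))) := by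
    intro t hmt
    rw [hY, mem_filter, compl_sdiff_eq_of_subset hmt, compl_union_eq, faceRefl_faceRefl hmt]; simp
  -- L_P and κ_rel as sums over Φ (P ⊆ Φ)
  have hPΦ : P ⊆ Φ := fun t ht => by rw [hΦ, mem_filter]; exact ⟨mem_univ _, hPm t ht⟩
  have sumP : ∀ g : Finset γ → ℤ, ∑ t ∈ P, g t = ∑ t ∈ Φ, ibit (t ∈ P) * g t := by
    intro g
    have hPF : Φ.filter (fun t => t ∈ P) = P := by rw [Finset.filter_mem_eq_inter, inter_eq_right.2 hPΦ]
    conv_lhs => rw [← hPF]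
    rw [Finset.sum_filter]
    refine Finset.sum_congr rfl fun t _ => ?_
    unfold ibit; split_ifs <;> simp
  have eL : lForm P A B = ∑ t ∈ P, (ibit (tᶜ ∈ A) * ibit (t ∈ B) + ibit (t ∈ A) * ibit (tᶜ ∈ B) - ibit (tᶜ ∈ A) * ibit (tᶜ ∈ B)) := by
    unfold lForm
    rw [card_refl_inter_inter, card_inter_inter_eq_sum_ibit, card_inter_inter_eq_sum_ibit, card_inter_inter_eq_sum_ibit]
    have h1 : ∀ t, ibit (t ∈ refl A) = ibit (tᶜ ∈ A) := by intro t; unfold ibit; simp only [mem_refl]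
    have h2 : ∀ t, ibit (t ∈ refl B) = ibit (tᶜ ∈ B) := by intro t; unfold ibit; simp only [mem_refl]
    simp only [h1, h2, ← Finset.sum_add_distrib, ← Finset.sum_sub_distrib]
  -- extra term ≥ 0 is a sum of a pointwise non-negative function
  -- the identity: per point of Φ, κ_rel − L − [X·(Y − Yᶜ) + extra] integrand is `relD` of the bits; sum over Φ vanishes by the involution ρ
  let bit : Finset γ → (Bool × Bool × Bool × Bool × Bool × Bool × Bool × Bool × Bool × Bool) := fun t =>
    (decide (t ∈ P), decide (m ∪ tᶜ ∈ P), decide (t ∈ A), decide (t \ m ∈ A), decide (m ∪ tᶜ ∈ A), decide (tᶜ ∈ A),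
     decide (t ∈ B), decide (t \ m ∈ B), decide (m ∪ tᶜ ∈ B), decide (tᶜ ∈ B))
  let D : Finset γ → ℤ := fun t =>
    relD (decide (t ∈ P)) (decide (m ∪ tᶜ ∈ P)) (decide (t ∈ A)) (decide (t \ m ∈ A)) (decide (m ∪ tᶜ ∈ A)) (decide (tᶜ ∈ A))
      (decide (t ∈ B)) (decide (t \ m ∈ B)) (decide (m ∪ tᶜ ∈ B)) (decide (tᶜ ∈ B))
  have hDpair : ∀ t ∈ Φ, D t + D (m ∪ tᶜ) = 0 := by
    intro t ht
    have hmt := hm_of_face ht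
    have hρρ := faceRefl_faceRefl hmt
    -- bits of ρt
    have e1 : (m ∪ tᶜ) \ m = tᶜ := faceRefl_sdiff hmt
    have e2 : m ∪ (m ∪ tᶜ)ᶜ = t := hρρ
    have e3 : (m ∪ tᶜ)ᶜ = t \ m := compl_faceRefl m t
    show relD _ _ _ _ _ _ _ _ _ _ + relD _ _ _ _ _ _ _ _ _ _ = 0
    rw [e1, e2, e3]
    refine relPair_eq_zero _ _ _ _ _ _ _ _ _ _ ?_ ?_ ?_ ?_ ?_
    · rcases hsat t hmt with h | h <;> simp [h]
    · intro h; have h' : t \ m ∈ A := of_decide_eq_true h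
      exact decide_eq_true (hA (show t \ m ≤ t from sdiff_subset) h')
    · intro h; have h' : tᶜ ∈ A := of_decide_eq_true h
      exact decide_eq_true (hA (show tᶜ ≤ m ∪ tᶜ from subset_union_right) h')
    · intro h; have h' : t \ m ∈ B := of_decide_eq_true h
      exact decide_eq_true (hB (show t \ m ≤ t from sdiff_subset) h')
    · intro h; have h' : tᶜ ∈ B := of_decide_eq_true h
      exact decide_eq_true (hB (show tᶜ ≤ m ∪ tᶜ from subset_union_right) h')
  have hDsum : ∑ t ∈ Φ, D t = 0 := by
    have hre : ∑ t ∈ Φ, D t = ∑ t ∈ Φ, D (m ∪ tᶜ) := by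
      refine Finset.sum_nbij' (fun t => m ∪ tᶜ) (fun s => m ∪ sᶜ) ?_ ?_ ?_ ?_ ?_
      · intro t _; rw [hΦ, mem_filter]; exact ⟨mem_univ _, subset_union_left⟩
      · intro s _; rw [hΦ, mem_filter]; exact ⟨mem_univ _, subset_union_left⟩
      · intro t ht; exact faceRefl_faceRefl (hm_of_face ht)
      · intro s hs; exact faceRefl_faceRefl (hm_of_face hs)
      · intro t ht; simp only [faceRefl_faceRefl (hm_of_face ht)]
    have h2 : ∑ t ∈ Φ, D t + ∑ t ∈ Φ, D (m ∪ tᶜ) = 0 := by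
      rw [← Finset.sum_add_distrib]; exact Finset.sum_eq_zero hDpair
    rw [← hre] at h2; linarith
  -- unfold D into the ibit-language integrands
  have hbz : ∀ (q : Prop) [Decidable q], bz (decide q) = ibit q := by
    intro q _; unfold bz ibit; by_cases h : q <;> simp [h]
  have eD : ∀ t ∈ Φ, D t =
      ibit (t ∈ P) * (ibit (m ∪ tᶜ ∈ P) * ibit (t ∈ A) * ibit (m ∪ tᶜ ∈ B) + (1 - ibit (m ∪ tᶜ ∈ P)) * ibit (t ∈ A) * ibit (t ∈ B)
          - ibit (tᶜ ∈ A) * ibit (t ∈ B) - ibit (t ∈ A) * ibit (tᶜ ∈ B) + ibit (tᶜ ∈ A) * ibit (tᶜ ∈ B))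
        - (ibit (t ∈ X) * (ibit (t ∈ Y) - ibit (tᶜ ∈ Y))
           + ibit (t ∈ P) * ibit (m ∪ tᶜ ∈ P) * ibit (t ∈ A) * (1 - ibit (t \ m ∈ A)) * ibit (m ∪ tᶜ ∈ B) * (1 - ibit (tᶜ ∈ B))) := by
    intro t ht
    have hmt := hm_of_face ht
    have hx : ibit (t ∈ X) = bz (decide (t \ m ∈ A) || (decide (t ∈ P) && !decide (m ∪ tᶜ ∈ P) && decide (t ∈ A))) := by
      unfold ibit bz; simp only [memX hmt]
      by_cases h1 : t \ m ∈ A <;> by_cases h2 : t ∈ P <;> by_cases h3 : m ∪ tᶜ ∈ P <;> by_cases h4 : t ∈ A <;> simp [h1, h2, h3, h4]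
    have hy : ibit (t ∈ Y) = bz (decide (t \ m ∈ B) || (decide (t ∈ P) && !decide (m ∪ tᶜ ∈ P) && decide (t ∈ B))) := by
      unfold ibit bz; simp only [memY hmt]
      by_cases h1 : t \ m ∈ B <;> by_cases h2 : t ∈ P <;> by_cases h3 : m ∪ tᶜ ∈ P <;> by_cases h4 : t ∈ B <;> simp [h1, h2, h3, h4]
    have hyc : ibit (tᶜ ∈ Y) = bz (decide (tᶜ ∈ B) || (decide (m ∪ tᶜ ∈ P) && !decide (t ∈ P) && decide (m ∪ tᶜ ∈ B))) := by
      unfold ibit bz; simp only [memYc hmt]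
      by_cases h1 : tᶜ ∈ B <;> by_cases h2 : m ∪ tᶜ ∈ P <;> by_cases h3 : t ∈ P <;> by_cases h4 : m ∪ tᶜ ∈ B <;> simp [h1, h2, h3, h4]
    show relD _ _ _ _ _ _ _ _ _ _ = _
    unfold relD
    rw [← hx, ← hy, ← hyc]
    simp only [hbz]
    ring
  -- conclude: κ_rel − L_P = (Kleitman bracket) + extra, as sums over Φ
  have ePt : ptVal (kapRel m P) A B = ∑ t ∈ Φ, ibit (t ∈ P) * (ibit (m ∪ tᶜ ∈ P) * ibit (t ∈ A) * ibit (m ∪ tᶜ ∈ B)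
      + (1 - ibit (m ∪ tᶜ ∈ P)) * ibit (t ∈ A) * ibit (t ∈ B)) := by
    rw [ptVal_kapRel, sumP]
    refine Finset.sum_congr rfl fun t _ => ?_
    unfold ibit; split_ifs <;> ring
  have eL' : lForm P A B = ∑ t ∈ Φ, ibit (t ∈ P) * (ibit (tᶜ ∈ A) * ibit (t ∈ B) + ibit (t ∈ A) * ibit (tᶜ ∈ B) - ibit (tᶜ ∈ A) * ibit (tᶜ ∈ B)) := by
    rw [eL, sumP]
  have hextra : 0 ≤ ∑ t ∈ Φ, ibit (t ∈ P) * ibit (m ∪ tᶜ ∈ P) * ibit (t ∈ A) * (1 - ibit (t \ m ∈ A)) * ibit (m ∪ tᶜ ∈ B) * (1 - ibit (tᶜ ∈ B)) := by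
    refine Finset.sum_nonneg fun t _ => ?_
    unfold ibit; split_ifs <;> simp
  have hk' : ((X ∩ refl Y).card : ℤ) ≤ (X ∩ Y).card := by exact_mod_cast hk
  rw [eXY, eXrY] at hk'
  have hId : ∑ t ∈ Φ, ((ibit (t ∈ P) * (ibit (m ∪ tᶜ ∈ P) * ibit (t ∈ A) * ibit (m ∪ tᶜ ∈ B) + (1 - ibit (m ∪ tᶜ ∈ P)) * ibit (t ∈ A) * ibit (t ∈ B))
        - ibit (t ∈ P) * (ibit (tᶜ ∈ A) * ibit (t ∈ B) + ibit (t ∈ A) * ibit (tᶜ ∈ B) - ibit (tᶜ ∈ A) * ibit (tᶜ ∈ B)))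
        - (ibit (t ∈ X) * ibit (t ∈ Y) - ibit (t ∈ X) * ibit (tᶜ ∈ Y)
           + ibit (t ∈ P) * ibit (m ∪ tᶜ ∈ P) * ibit (t ∈ A) * (1 - ibit (t \ m ∈ A)) * ibit (m ∪ tᶜ ∈ B) * (1 - ibit (tᶜ ∈ B)))) = 0 := by
    rw [← hDsum]
    refine Finset.sum_congr rfl fun t ht => ?_
    rw [eD t ht]; ring
  rw [← sub_nonneg, ePt, eL', ← Finset.sum_sub_distrib]
  rw [Finset.sum_sub_distrib] at hId
  -- Σ(F) = Σ(G) = Σ XY − Σ XYᶜ + Σ extra ≥ 0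
  have hG : 0 ≤ ∑ t ∈ Φ, (ibit (t ∈ X) * ibit (t ∈ Y) - ibit (t ∈ X) * ibit (tᶜ ∈ Y)
           + ibit (t ∈ P) * ibit (m ∪ tᶜ ∈ P) * ibit (t ∈ A) * (1 - ibit (t \ m ∈ A)) * ibit (m ∪ tᶜ ∈ B) * (1 - ibit (tᶜ ∈ B))) := by
    rw [Finset.sum_add_distrib, Finset.sum_sub_distrib]; linarith
  linarith

omit [DecidableEq β] [Fintype β] in
/-- **The cross-point weight `κ_rel` is a sandwich certificate for every relatively saturated up-set.** [this work] -/
theorem sandwichPt_kapRel {m : Finset γ} {P : Finset (Finset γ)} (hP : IsUpperSet (P : Set (Finset γ)))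
    (hPm : ∀ t ∈ P, m ⊆ t) (hsat : ∀ t : Finset γ, m ⊆ t → t ∈ P ∨ m ∪ tᶜ ∈ P) : SandwichPt P 1 (kapRel m P) := by
  intro A B hA hB
  refine ⟨?_, ?_⟩
  · rw [Nat.cast_one, one_mul]; exact lForm_le_ptVal_kapRel hP hPm hsat hA hB
  · rw [Nat.cast_one, one_mul]; exact ptVal_kapRel_le_uForm hP hPm hA hB


/-- **`TriWIneq` ON THE RELATIVELY SATURATED STRATUM.**  If the up-set `P` lies in the face `↑m` and is saturated there (`t ∈ P ∨ m ∪ tᶜ ∈ P` for every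
`t ⊇ m`), then `0 ≤ triW P F G` for EVERY index cube `Finset β` and all monotone families `F, G` of up-sets (all `n`, all `a`).  Contains the saturated
stratum (`m = ∅`, `triW_nonneg_of_saturated`) and every principal up-set (`P = ↑m`). [this work] -/
theorem triW_nonneg_of_relSaturated {m : Finset γ} {P : Finset (Finset γ)} (hP : IsUpperSet (P : Set (Finset γ)))
    (hPm : ∀ t ∈ P, m ⊆ t) (hsat : ∀ t : Finset γ, m ⊆ t → t ∈ P ∨ m ∪ tᶜ ∈ P) (F G : Finset β → Finset (Finset γ))
    (hF : ∀ x, IsUpperSet (F x : Set (Finset γ))) (hG : ∀ x, IsUpperSet (G x : Set (Finset γ)))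
    (hFm : Monotone F) (hGm : Monotone G) :
    0 ≤ triW P F G :=
  triW_nonneg_of_sandwichPt Nat.one_pos (sandwichPt_kapRel hP hPm hsat) F G hF hG hFm hGm

/-- **Principal up-sets again** (`P = ↑m`, the whole face; a second proof of `triW_nonneg_of_principal`, via the cross-point certificate). [this work] -/
theorem triW_nonneg_principal' (m : Finset γ) (F G : Finset β → Finset (Finset γ))
    (hF : ∀ x, IsUpperSet (F x : Set (Finset γ))) (hG : ∀ x, IsUpperSet (G x : Set (Finset γ)))
    (hFm : Monotone F) (hGm : Monotone G) :
    0 ≤ triW (univ.filter fun t : Finset γ => m ⊆ t) F G := by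
  refine triW_nonneg_of_relSaturated (isUpperSet_principal m) (fun t ht => (mem_filter.1 ht).2) (fun t ht => ?_) F G hF hG hFm hGm
  exact Or.inl (mem_filter.2 ⟨mem_univ _, ht⟩)

end FiveUpSet

end Summit.CriticalPhenomena.PercolationContinuityZ3.Theorems
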